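import Summits.PneNP.PneNP.Theorems.Nc03AvoidResidualCoreCandMatchRungPack
import Summits.PneNP.PneNP.Theorems.Nc03AvoidResidualCoreReductionFrame

/-!
# Pure-`CAND` range avoidance — the tangled / untangled split and cherry forcing

Support lemmas for the crux `Summit.PneNP.PneNP.Theses.Nc03AvoidResidualCore.CandAvoidLinearFP`
(stmt-PneNP-20226) and for the proposed reduction piece `CandStarReduction`
("CAND^match-AVOID-linear ∈ FP ⇒ CAND^pure-AVOID-linear ∈ FP", cell memo pnp-ideate-p2
ROUND-3-ADDENDUM-B, Thm B.1 ★): the first lemmas of ★, all elementary and sorry-free.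

* `tangled I` — the outputs that share their head AND a data variable with another output; the
  complementary ("untangled") outputs of any 3-local instance restrict to a MATCHING-CLASS sub-instance
  (`untangled_isMatchingClass`), pure if `I` is (`restrict_isPure`), on the same inputs — the case
  `#(tangled I) ≤ n` of ★ is thus literally an instance of the matching-class core, via the sub-instance
  principle `Nc03Reduction.not_mem_range_of_restrict` of `…ReductionFrame`.
* (F2) CHERRY FORCING `apex_eq_true_of_cherry`: two outputs `j = (c; u, w)` and `j' = (c; u, w')` with the
  same head `c` and a common data variable ("apex") `u` satisfy `y_j ⊕ y_{j'} = x_u · (x_w ⊕ x_{w'})`, so a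
  target with `y_j ≠ y_{j'}` FORCES `x_u = 1` in every preimage; and once `x_u = 1`, every output having `u`
  as a data variable reads the AFFINE function `x_{c'} ⊕ x_{w}` (`eval_of_data_true₁/₂`).
  ((F1), the parallel kill, is `…CandFewHeadsRung.not_mem_range_of_parallel`.)

Restricted-model (NC⁰₃) range-avoidance rung F-N1b of the PneNP frontier ladder; no bearing on P vs NP.
-/

namespace Summit.PneNP.PneNP.Theorems.Nc03AvoidResidualCoreCandCherry

open Finset
open Literature.Computability.Complexity
open Summit.PneNP.PneNP.Theorems.Nc03AvoidResidualCoreCandFewHeadsRung (pset headCount eval_eq)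
open Summit.PneNP.PneNP.Theorems.Nc03AvoidResidualCoreCandMatchRung (IsMatchingClass)
open Summit.PneNP.PneNP.Theorems.Nc03Reduction (restrict restrict_eval not_mem_range_of_restrict)

variable {n m m' : ℕ}

/-! ## Tangled and untangled outputs -/

/-- The TANGLED outputs of a 3-local instance: output `j` is tangled if some other output with the same
head (role `0`) shares a data variable with it (roles `1, 2`, in either role). (Cell memo
ROUND-3-ADDENDUM-B: the set `L`.) -/
def tangled (I : LocalMap 3 n m) : Finset (Fin m) :=
  univ.filter fun j => ∃ j' : Fin m, j' ≠ j ∧ I.vars j' 0 = I.vars j 0 ∧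
    ∃ a b : Fin 3, a ≠ 0 ∧ b ≠ 0 ∧ I.vars j a = I.vars j' b

/-- Unfolding membership in `tangled I`. -/
theorem mem_tangled {I : LocalMap 3 n m} {j : Fin m} :
    j ∈ tangled I ↔ ∃ j' : Fin m, j' ≠ j ∧ I.vars j' 0 = I.vars j 0 ∧
      ∃ a b : Fin 3, a ≠ 0 ∧ b ≠ 0 ∧ I.vars j a = I.vars j' b := by
  simp only [tangled, mem_filter, mem_univ, true_and]

/-- Tangledness is symmetric in the two outputs involved. -/
theorem mem_tangled_of_shared {I : LocalMap 3 n m} {j j' : Fin m} (hjj' : j ≠ j')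
    (hhead : I.vars j 0 = I.vars j' 0) {a b : Fin 3} (ha : a ≠ 0) (hb : b ≠ 0)
    (hab : I.vars j a = I.vars j' b) : j ∈ tangled I ∧ j' ∈ tangled I :=
  ⟨mem_tangled.2 ⟨j', hjj'.symm, hhead.symm, a, b, ha, hb, hab⟩,
    mem_tangled.2 ⟨j, hjj', hhead, b, a, hb, ha, hab.symm⟩⟩

/-- **The untangled outputs form a matching-class sub-instance**: restricting ANY 3-local instance to
outputs outside `tangled I` (along an injective index map) gives an `IsMatchingClass` instance. -/
theorem untangled_isMatchingClass (I : LocalMap 3 n m) (ι : Fin m' → Fin m)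
    (hι : Function.Injective ι) (hU : ∀ i, ι i ∉ tangled I) : IsMatchingClass (restrict I ι) := by
  intro j j' hjj' hhead a b ha hb hab
  exact hU j (mem_tangled.2 ⟨ι j', fun h => hjj' (hι h).symm, hhead.symm, a, b, ha, hb, hab⟩)

/-- Restriction preserves purity. -/
theorem restrict_isPure {k : ℕ} {P : (Fin k → Bool) → Bool} {I : LocalMap k n m}
    (hI : I.IsPure P) (ι : Fin m' → Fin m) : (restrict I ι).IsPure P :=
  ⟨fun j => hI.1 (ι j), fun j => hI.2 (ι j)⟩

/-- The untangled outputs number `m - #(tangled I)`. -/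
theorem card_compl_tangled (I : LocalMap 3 n m) : #((tangled I)ᶜ) = m - #(tangled I) := by
  rw [Finset.card_compl, Fintype.card_fin]

/-- **The untangled case of ★, pointwise**: if a target's restriction to an injective family of untangled
outputs lies outside the range of that (pure, matching-class) sub-instance, the target lies outside the
range of `I`. (Just `not_mem_range_of_restrict`; recorded with the side facts a solver needs.) -/
theorem not_mem_range_of_untangled {I : LocalMap 3 n m} (hI : I.IsPure candPred)
    (ι : Fin m' → Fin m) (hι : Function.Injective ι) (hU : ∀ i, ι i ∉ tangled I)
    {y : Fin m → Bool} (h : (fun i => y (ι i)) ∉ (restrict I ι).range) :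
    y ∉ I.range ∧ (restrict I ι).IsPure candPred ∧ IsMatchingClass (restrict I ι) :=
  ⟨not_mem_range_of_restrict I ι h, restrict_isPure hI ι, untangled_isMatchingClass I ι hι hU⟩

/-! ## (F2) Cherry forcing and the affine read-out -/

/-- The `AND`-part of a pure-`CAND` output vanishes when one of its data variables is `false`. -/
theorem eval_of_data_false {I : LocalMap 3 n m} (hI : I.IsPure candPred) (x : Fin n → Bool)
    {j : Fin m} {r : Fin 3} (hr : r ≠ 0) (hx : x (I.vars j r) = false) :
    I.eval x j = x (I.vars j 0) := by
  rw [eval_eq hI]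
  have hr' : r = 1 ∨ r = 2 := by
    rcases r with ⟨_ | _ | _ | r, hr3⟩
    · exact absurd rfl hr
    · exact Or.inl rfl
    · exact Or.inr rfl
    · omega
  rcases hr' with rfl | rfl
  · rw [hx, Bool.false_and, Bool.xor_false]
  · rw [hx, Bool.and_false, Bool.xor_false]

/-- **Cherry forcing (F2).** Two outputs with the same head and a common data variable `u` (in any data
roles) take EQUAL values on every input with `x_u = 0`; … -/
theorem eval_eq_eval_of_apex_false {I : LocalMap 3 n m} (hI : I.IsPure candPred) (x : Fin n → Bool)
    {j j' : Fin m} (hhead : I.vars j 0 = I.vars j' 0) {r r' : Fin 3} (hr : r ≠ 0) (hr' : r' ≠ 0)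
    (hapex : I.vars j r = I.vars j' r') (hx : x (I.vars j r) = false) :
    I.eval x j = I.eval x j' := by
  rw [eval_of_data_false hI x hr hx, eval_of_data_false hI x hr' (hapex ▸ hx), hhead]

/-- … hence a target separating them FORCES the apex: every preimage has `x_u = 1`. -/
theorem apex_eq_true_of_cherry {I : LocalMap 3 n m} (hI : I.IsPure candPred) {x : Fin n → Bool}
    {y : Fin m → Bool} (hxy : I.eval x = y) {j j' : Fin m} (hhead : I.vars j 0 = I.vars j' 0)
    {r r' : Fin 3} (hr : r ≠ 0) (hr' : r' ≠ 0) (hapex : I.vars j r = I.vars j' r')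
    (hy : y j ≠ y j') : x (I.vars j r) = true := by
  by_contra hx
  rw [Bool.not_eq_true] at hx
  exact hy (by rw [← hxy]; exact eval_eq_eval_of_apex_false hI x hhead hr hr' hapex hx)

/-- **Affine read-out.** Once the data variable in role `1` is `true`, a pure-`CAND` output reads the
affine function `x_{c} ⊕ x_{w}` of its head and its other data variable. -/
theorem eval_of_data_true₁ {I : LocalMap 3 n m} (hI : I.IsPure candPred) (x : Fin n → Bool)
    {j : Fin m} (hx : x (I.vars j 1) = true) :
    I.eval x j = xor (x (I.vars j 0)) (x (I.vars j 2)) := by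
  rw [eval_eq hI, hx, Bool.true_and]

/-- Affine read-out, role `2` version. -/
theorem eval_of_data_true₂ {I : LocalMap 3 n m} (hI : I.IsPure candPred) (x : Fin n → Bool)
    {j : Fin m} (hx : x (I.vars j 2) = true) :
    I.eval x j = xor (x (I.vars j 0)) (x (I.vars j 1)) := by
  rw [eval_eq hI, hx, Bool.and_true]

/-- **The cherry equation.** For two outputs with a common head `c` and a common apex in role `1`,
`y_j ⊕ y_{j'} = x_u ∧ (x_w ⊕ x_{w'})` where `w, w'` are the role-`2` variables — the identity behind (F2)
and behind the 𝔽₂ "cherry system" `y_{e_u} ⊕ y_{e'_u} = 1` of the forcing forest. -/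
theorem cherry_xor₁₁ {I : LocalMap 3 n m} (hI : I.IsPure candPred) (x : Fin n → Bool)
    {j j' : Fin m} (hhead : I.vars j 0 = I.vars j' 0) (hapex : I.vars j 1 = I.vars j' 1) :
    xor (I.eval x j) (I.eval x j') = (x (I.vars j 1) && xor (x (I.vars j 2)) (x (I.vars j' 2))) := by
  rw [eval_eq hI, eval_eq hI, ← hhead, ← hapex]
  generalize x (I.vars j 0) = H
  generalize x (I.vars j 1) = U
  generalize x (I.vars j 2) = W
  generalize x (I.vars j' 2) = W'
  revert H U W W'
  decide

end Summit.PneNP.PneNP.Theorems.Nc03AvoidResidualCoreCandCherry
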